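import Summits.NavierStokesRegularity.FluidComputer.PalasekTowerHostCutoff
import Literature.Analysis.FluidPDE.DistributionalToWeakCounterexample

/-!
# Host preparation, IV: the placed, dilated bump field (the quasi-static carrier of the speed maximum)

Cell `ns-blowup`, seat `ns-blowup-ecbridge-3` (g0); GROUP C «BRIDGE SUPPORT» of the route
`PalasekTowerBreakdown` (crux `EpisodeBaseG`, item stmt-NavierStokesRegularity-19179, BC3 stub
`host_preparation` = the tree Prop `RungG 0`). LABEL: E–C typing (KERNEL construction). WHAT THIS
IS NOT: not Navier–Stokes evidence — calculus of an explicit compactly supported divergence-free field.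

The second piece of the level-`0` host: a FIXED smooth, compactly supported, divergence-free,
non-zero field `θ = curl (η e₂)` (the tree's
`Literature.Analysis.FluidPDE.DistributionalToWeakCounterexample.θ`, supported in `B̄(0, 2)`),
PLACED at a centre `c` and DILATED by `L`: `place g c L x = g ((x - c)/L)`.

* §1 `θ` attains its maximal speed `M = ‖θ x⋆‖ > 0` (`thetaMax`, `thetaArgmax`); its support;
  uniform bounds on `(θ·∇)θ` and `curl curl θ` (compactness; existential constants);
* §2 `place g c L`: smoothness, support in `B̄(c, 2L)`, the chain rules
  `D(place g) = L⁻¹ Dg ∘`, `curl (place g) = L⁻¹ place (curl g)`,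
  `curl curl (place g) = L⁻² place (curl curl g)`, `((place g)·∇)(place g) = L⁻¹ place ((g·∇)g)`,
  divergence-freeness, and `Δ (place θ) = −curl curl (place θ)` (tree `laplacian_eq_neg_curl_curl`);
* §3 `bump_scale_bounds`: for `L ≥ 1`, `‖((place θ c L)·∇)(place θ c L)‖ ≤ C/L` and
  `‖curl curl (place θ c L)‖ ≤ C/L` uniformly; the speed maximum `M` is attained at `c + L x⋆`.

References: A. J. Majda, A. L. Bertozzi, *Vorticity and Incompressible Flow* (CUP 2002), §1.1
(vector identities) [cite: MajdaBertozziCUP2002, §1.1]; S. Palasek, arXiv:2605.13827 §4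
[cite: Palasek2026ElementaryModel, §4].
-/

noncomputable section

namespace Summit.NavierStokesRegularity.FluidComputer.PalasekTowerClayBridge.Host

open Real Set Function Filter Topology InnerProductSpace Metric
open scoped RealInnerProductSpace ContDiff Topology Laplacian

open Literature.Analysis.FluidPDE
open Literature.Analysis.FluidPDE.DistributionalToWeakCounterexample (θ θ_contDiff θ_hasCompactSupport
  θ_isDivFree exists_θ_ne_zero Φ Φ_hasCompactSupport η η_hasCompactSupport)

/-- Local notation for physical space `ℝ³ = EuclideanSpace ℝ (Fin 3)`. -/
local notation "ℝ³" => EuclideanSpace ℝ (Fin 3)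

/-! ## §1 The fixed bump field `θ` -/

/-- The bump field `θ` of the tree is differentiable (field form, for the chain rules below).
[folklore] -/
theorem theta_differentiable : Differentiable ℝ fun x : ℝ³ => θ x :=
  θ_contDiff.differentiable (by simp)

/-- **The speed of `θ` attains a positive maximum.** [folklore] -/
theorem exists_thetaMax : ∃ x₀ : ℝ³, (∀ y, ‖θ y‖ ≤ ‖θ x₀‖) ∧ 0 < ‖θ x₀‖ := by
  obtain ⟨x₀, hx₀⟩ := θ_contDiff.continuous.norm.exists_forall_ge_of_hasCompactSupport
    θ_hasCompactSupport.norm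
  obtain ⟨x₁, hx₁⟩ := exists_θ_ne_zero
  exact ⟨x₀, hx₀, lt_of_lt_of_le (norm_pos_iff.2 hx₁) (hx₀ x₁)⟩

/-- A point where the speed of `θ` is maximal. [folklore] -/
def thetaArgmax : ℝ³ := Classical.choose exists_thetaMax

/-- The maximal speed `M` of `θ`. [folklore] -/
def thetaMax : ℝ := ‖θ thetaArgmax‖

/-- `‖θ y‖ ≤ M`. [folklore] -/
theorem norm_theta_le (y : ℝ³) : ‖θ y‖ ≤ thetaMax := (Classical.choose_spec exists_thetaMax).1 y

/-- `0 < M`. [folklore] -/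
theorem thetaMax_pos : 0 < thetaMax := (Classical.choose_spec exists_thetaMax).2

/-- **Support of `θ`**: `tsupport θ ⊆ B̄(0, 2)` (`θ = curl (η e₂)`, `η` the bump `1` on `B̄(0,1)`,
`0` off `B(0,2)`). [folklore] -/
theorem tsupport_theta_subset : tsupport θ ⊆ Metric.closedBall (0 : ℝ³) 2 := by
  have h1 : tsupport θ ⊆ tsupport Φ :=
    tsupport_subset_of_eq_zero' fun x hx => curl_eq_zero_of_notMem_tsupport hx
  have h2 : tsupport Φ ⊆ tsupport η := by
    refine closure_minimal (fun x hx => ?_) (isClosed_tsupport _)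
    by_contra h
    apply hx
    show η x • (EuclideanSpace.single 2 1 : ℝ³) = 0
    rw [image_eq_zero_of_notMem_tsupport h, zero_smul]
  have h3 : tsupport η = Metric.closedBall (0 : ℝ³) 2 :=
    DistributionalToWeakCounterexample.bump.tsupport_eq
  exact h1.trans (h2.trans h3.le)
where
  /-- A function vanishing off `tsupport g` has `tsupport ⊆ tsupport g`. [folklore] -/
  tsupport_subset_of_eq_zero' {f g : ℝ³ → ℝ³} (h : ∀ x, x ∉ tsupport g → f x = 0) :
      tsupport f ⊆ tsupport g := by
    refine closure_minimal (fun x hx => ?_) (isClosed_tsupport g)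
    by_contra hxg
    exact hx (h x hxg)

/-- A maximiser lies in `B̄(0, 2)`. [folklore] -/
theorem norm_thetaArgmax_le : ‖thetaArgmax‖ ≤ 2 := by
  have h : thetaArgmax ∈ tsupport θ :=
    subset_tsupport _ (by rw [mem_support]; exact norm_pos_iff.1 thetaMax_pos)
  have := tsupport_theta_subset h
  rwa [Metric.mem_closedBall, dist_zero_right] at this

/-- **Uniform bounds on `(θ·∇)θ` and `curl curl θ`** (continuous with compact support). [folklore] -/
theorem exists_theta_bounds :
    ∃ C : ℝ, 0 ≤ C ∧ ∀ y : ℝ³, ‖convect θ θ y‖ ≤ C ∧ ‖curl (curl θ) y‖ ≤ C := by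
  have hcv : Continuous (convect θ θ) :=
    DistributionalToWeakCounterexample.convect_θ_continuous
  have hcvs : HasCompactSupport (convect θ θ) := by
    refine θ_hasCompactSupport.mono fun x hx => ?_
    rw [mem_support] at hx ⊢
    contrapose! hx
    simp [convect, hx]
  obtain ⟨C₁, hC₁⟩ := hcv.bounded_above_of_compact_support hcvs
  have hcurl1 : ContDiff ℝ ∞ (curl θ) :=
    contDiff_curl (n := ⊤) (θ_contDiff.of_le (by exact_mod_cast le_top))
  have hcc : Continuous (curl (curl θ)) := continuous_curl (contDiff_infty.1 hcurl1 1)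
  have hccs : HasCompactSupport (curl (curl θ)) :=
    hasCompactSupport_curl (hasCompactSupport_curl θ_hasCompactSupport)
  obtain ⟨C₂, hC₂⟩ := hcc.bounded_above_of_compact_support hccs
  have h1 : 0 ≤ C₁ := (norm_nonneg _).trans (hC₁ 0)
  refine ⟨max C₁ C₂, le_max_of_le_left h1, fun y => ⟨(hC₁ y).trans (le_max_left _ _),
    (hC₂ y).trans (le_max_right _ _)⟩⟩

/-! ## §2 Placing and dilating a field -/

section Place

variable (g : ℝ³ → ℝ³) (c : ℝ³) (L : ℝ)

/-- The affine change of variables `x ↦ (x - c)/L`. [folklore] -/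
def rescale (x : ℝ³) : ℝ³ := (L⁻¹ : ℝ) • (x - c)

/-- **The placed, dilated field** `place g c L x = g ((x - c)/L)`. [folklore] -/
def place (x : ℝ³) : ℝ³ := g (rescale c L x)

variable {g c L}

/-- The change of variables has derivative the dilation `L⁻¹ • id`. [folklore] -/
theorem hasFDerivAt_rescale (x : ℝ³) : HasFDerivAt (rescale c L) (dilation L) x :=
  ((hasFDerivAt_id x).sub_const c).const_smul L⁻¹

/-- The change of variables is smooth. [folklore] -/
theorem contDiff_rescale : ContDiff ℝ ∞ (rescale c L) :=
  (contDiff_id.sub contDiff_const).const_smul L⁻¹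

/-- The change of variables inverts `y ↦ c + L y`. [folklore] -/
theorem rescale_center_add (hL : L ≠ 0) (y : ℝ³) : rescale c L (c + L • y) = y := by
  simp [rescale, smul_smul, inv_mul_cancel₀ hL]

/-- The placed field is smooth when `g` is. [folklore] -/
theorem contDiff_place (hg : ContDiff ℝ ∞ g) : ContDiff ℝ ∞ (place g c L) :=
  hg.comp contDiff_rescale

/-- Chain rule for the placed field. [folklore] -/
theorem hasFDerivAt_place (hg : Differentiable ℝ g) (x : ℝ³) :
    HasFDerivAt (place g c L) ((fderiv ℝ g (rescale c L x)).comp (dilation L)) x :=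
  (hg (rescale c L x)).hasFDerivAt.comp x (hasFDerivAt_rescale x)

/-- `Dg(y) ∘ (L⁻¹ id) = L⁻¹ Dg(y)`. [folklore] -/
theorem comp_dilation (A : ℝ³ →L[ℝ] ℝ³) : A.comp (dilation L) = (L⁻¹ : ℝ) • A := by
  ext v i
  simp [dilation]

/-- **`D(place g)(x) = L⁻¹ • Dg((x-c)/L)`.** [folklore] -/
theorem fderiv_place (hg : Differentiable ℝ g) (x : ℝ³) :
    fderiv ℝ (place g c L) x = (L⁻¹ : ℝ) • fderiv ℝ g (rescale c L x) := by
  rw [(hasFDerivAt_place hg x).fderiv, comp_dilation]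

/-- The placed field is differentiable. [folklore] -/
theorem differentiable_place (hg : Differentiable ℝ g) : Differentiable ℝ (place g c L) := fun x =>
  (hasFDerivAt_place hg x).differentiableAt

/-- **`curl (place g) = L⁻¹ • place (curl g)`.** [folklore] -/
theorem curl_place (hg : Differentiable ℝ g) (x : ℝ³) :
    curl (place g c L) x = (L⁻¹ : ℝ) • place (curl g) c L x := by
  rw [curl_eq_curlCLM, fderiv_place hg, map_smul, place, curl_eq_curlCLM]

/-- `curl (place g)` as a function. [folklore] -/
theorem curl_place_eq (hg : Differentiable ℝ g) :
    curl (place g c L) = fun x => (L⁻¹ : ℝ) • place (curl g) c L x :=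
  funext (curl_place hg)

/-- **`curl curl (place g) = L⁻² • place (curl curl g)`** for `g ∈ C²`. [folklore] -/
theorem curl_curl_place (hg : ContDiff ℝ ∞ g) (x : ℝ³) :
    curl (curl (place g c L)) x = (L⁻¹ : ℝ) ^ 2 • place (curl (curl g)) c L x := by
  have hgd : Differentiable ℝ g := hg.differentiable (by simp)
  have hcg : Differentiable ℝ (curl g) :=
    (contDiff_curl (n := ⊤) (hg.of_le (by exact_mod_cast le_top))).differentiable (by simp)
  rw [curl_place_eq hgd, curl_const_smul (differentiable_place hcg x), curl_place hcg, smul_smul, sq]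

/-- **`((place g)·∇)(place g) = L⁻¹ • place ((g·∇)g)`.** [folklore] -/
theorem convect_place (hg : Differentiable ℝ g) (x : ℝ³) :
    convect (place g c L) (place g c L) x = (L⁻¹ : ℝ) • place (convect g g) c L x := by
  rw [convect_apply, fderiv_place hg]
  rfl

/-- **The placed field is divergence free when `g` is.** [folklore] -/
theorem isDivFree_place (hg : Differentiable ℝ g) (hdiv : VectorCalculus.IsDivFree g) :
    VectorCalculus.IsDivFree (place g c L) := fun x => by
  have := hdiv (rescale c L x)
  unfold VectorCalculus.divergence at this ⊢
  rw [fderiv_place hg]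
  simp [this]

/-- Off `B̄(c, 2L)` the change of variables leaves `B̄(0, 2)`. [folklore] -/
theorem two_lt_norm_rescale (hL : 0 < L) {x : ℝ³} (hx : 2 * L < ‖x - c‖) : 2 < ‖rescale c L x‖ := by
  rw [rescale, norm_smul, Real.norm_eq_abs, abs_of_pos (inv_pos.2 hL), lt_inv_mul_iff₀ hL]
  linarith

/-- Off `B̄(c, 2L)` the rescaled point is outside `tsupport g` (when `tsupport g ⊆ B̄(0,2)`). [folklore] -/
theorem rescale_notMem_tsupport (hsupp : tsupport g ⊆ Metric.closedBall (0 : ℝ³) 2) (hL : 0 < L)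
    {x : ℝ³} (hx : 2 * L < ‖x - c‖) : rescale c L x ∉ tsupport g := fun h => by
  have := hsupp h
  rw [Metric.mem_closedBall, dist_zero_right] at this
  linarith [two_lt_norm_rescale hL hx]

/-- **Support of the placed field**: if `tsupport g ⊆ B̄(0,2)` then `place g c L` vanishes off
`B̄(c, 2L)`. [folklore] -/
theorem place_eq_zero (hsupp : tsupport g ⊆ Metric.closedBall (0 : ℝ³) 2) (hL : 0 < L) {x : ℝ³}
    (hx : 2 * L < ‖x - c‖) : place g c L x = 0 :=
  show g (rescale c L x) = 0 from image_eq_zero_of_notMem_tsupport (rescale_notMem_tsupport hsupp hL hx)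

/-- Off `B̄(c, 2L)` the placed field has zero derivative. [folklore] -/
theorem fderiv_place_eq_zero (hg : Differentiable ℝ g)
    (hsupp : tsupport g ⊆ Metric.closedBall (0 : ℝ³) 2) (hL : 0 < L) {x : ℝ³}
    (hx : 2 * L < ‖x - c‖) : fderiv ℝ (place g c L) x = 0 := by
  rw [fderiv_place hg, fderiv_of_notMem_tsupport ℝ (rescale_notMem_tsupport hsupp hL hx)]
  exact smul_zero (A := ℝ³ →L[ℝ] ℝ³) (L⁻¹ : ℝ)

/-- The support of the placed field is in `B̄(c, 2L)`. [folklore] -/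
theorem tsupport_place_subset (hsupp : tsupport g ⊆ Metric.closedBall (0 : ℝ³) 2) (hL : 0 < L) :
    tsupport (place g c L) ⊆ Metric.closedBall c (2 * L) := by
  refine closure_minimal (fun x hx => ?_) Metric.isClosed_closedBall
  rw [Metric.mem_closedBall, dist_eq_norm]
  by_contra h
  exact hx (place_eq_zero hsupp hL (lt_of_not_ge h))

/-- The placed field has compact support. [folklore] -/
theorem hasCompactSupport_place (hsupp : tsupport g ⊆ Metric.closedBall (0 : ℝ³) 2) (hL : 0 < L) :
    HasCompactSupport (place g c L) :=
  IsCompact.of_isClosed_subset (isCompact_closedBall _ _) (isClosed_tsupport _)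
    (tsupport_place_subset hsupp hL)

end Place

/-! ## §3 The placed bump field `place θ c L` -/

/-- **The Laplacian of the placed bump field** is minus its double curl (divergence free, `C²`).
[folklore] -/
theorem laplacian_place_theta (c : ℝ³) (L : ℝ) (x : ℝ³) :
    (Δ (place θ c L)) x = -curl (curl (place θ c L)) x :=
  laplacian_eq_neg_curl_curl (contDiff_infty.1 (contDiff_place θ_contDiff) 2)
    (isDivFree_place theta_differentiable θ_isDivFree) x

/-- **The speed of the placed bump field is at most `M`, attained at `c + L x⋆`.** [folklore] -/
theorem norm_place_theta_le (c : ℝ³) (L : ℝ) (x : ℝ³) : ‖place θ c L x‖ ≤ thetaMax :=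
  norm_theta_le _

/-- The maximum is attained at `c + L x⋆`. [folklore] -/
theorem norm_place_theta_argmax (c : ℝ³) {L : ℝ} (hL : L ≠ 0) :
    ‖place θ c L (c + L • thetaArgmax)‖ = thetaMax := by
  rw [place, rescale_center_add hL]
  rfl

/-- The point of maximal speed lies within `2L` of the centre. [folklore] -/
theorem norm_argmax_point_sub_le (c : ℝ³) {L : ℝ} (hL : 0 < L) :
    ‖(c + L • thetaArgmax) - c‖ ≤ 2 * L := by
  rw [add_sub_cancel_left, norm_smul, Real.norm_eq_abs, abs_of_pos hL]
  nlinarith [norm_thetaArgmax_le, norm_nonneg thetaArgmax]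

/-- **Bump field bounds in the scale `L ≥ 1`**: `‖((place θ)·∇)(place θ)‖ ≤ C/L` and
`‖curl curl (place θ)‖ ≤ C/L`, uniformly in the centre and the point. [folklore] -/
theorem bump_scale_bounds :
    ∃ C : ℝ, 0 ≤ C ∧ ∀ (c : ℝ³) (L : ℝ), 1 ≤ L → ∀ x : ℝ³,
      ‖convect (place θ c L) (place θ c L) x‖ ≤ C / L ∧
      ‖curl (curl (place θ c L)) x‖ ≤ C / L := by
  obtain ⟨C, hC0, hC⟩ := exists_theta_bounds
  refine ⟨C, hC0, fun c L hL x => ?_⟩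
  have hLpos : 0 < L := lt_of_lt_of_le zero_lt_one hL
  have hinv : 0 ≤ (L⁻¹ : ℝ) := inv_nonneg.2 hLpos.le
  have hinv1 : (L⁻¹ : ℝ) ≤ 1 := inv_le_one_of_one_le₀ hL
  constructor
  · rw [convect_place theta_differentiable, norm_smul, Real.norm_eq_abs, abs_of_nonneg hinv,
      div_eq_mul_inv, mul_comm C]
    exact mul_le_mul_of_nonneg_left (hC _).1 hinv
  · rw [curl_curl_place θ_contDiff, norm_smul, Real.norm_eq_abs, abs_of_nonneg (pow_nonneg hinv 2),
      div_eq_mul_inv, mul_comm C]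
    refine mul_le_mul ?_ (hC _).2 (norm_nonneg _) hinv
    calc (L⁻¹ : ℝ) ^ 2 = L⁻¹ * L⁻¹ := sq _
      _ ≤ L⁻¹ * 1 := mul_le_mul_of_nonneg_left hinv1 hinv
      _ = L⁻¹ := mul_one _

end Summit.NavierStokesRegularity.FluidComputer.PalasekTowerClayBridge.Host

end
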